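import Mathlib
import Summits.Ventures.PercRepro2.SwOutArmCube

/-!
# The cube principle WITHOUT the swap: the rigid counting inequality on a cube whose red edge set
is increasing and whose side points satisfy `rm(ω̄) ⊆ bm(ω)` (blind cell PercRepro2, night-4 g36,
2026-08-29; proofs/NIGHT4-G36.md §4)

g10's `card_le_of_cube_edges` needs, on the WHOLE cube, the red edge set of `h` increasing, the
blue one decreasing and the flip of the cube exchanging them.  The half-flipped blocks of the impure
frontier (a decoration vertex of one unit adjacent to the arm of another) break the swap at their
non-side points only.  Harris on the cube uses just the lower set of side points and the up-set of
the red condition: `#(L ∩ A) ≤ #(L ∩ flipAll⁻¹ A)`; so it suffices that at every SIDE point `ω` the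
red edges of `h` at the antipode `flipAll ω` are blue edges of `h` at `ω` —
**`card_le_of_cube_edges_weak`**.  The census checks exactly these two conditions (c6, c7 of
mining/night-4/g36/shadow18.py) on the blocks of the private-attachment design.
-/

namespace Summit.Ventures.PercRepro2

namespace LocRows

open Hull

variable {V : Type*} {E : Type*} [Fintype E] [DecidableEq E]

open scoped Classical

variable {ends : E → Sym2 V}

section CubeWeak

omit [Fintype E] [DecidableEq E] in
/-- `flipAll` is antitone. -/
lemma flipAll_antitone_cube {E' : Type*} {ω ω' : Config E'} (h : ω ≤ ω') :
    flipAll ω' ≤ flipAll ω := by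
  intro e
  have := h e
  unfold flipAll
  cases hs : ω e <;> cases hs' : ω' e <;> simp_all

omit [DecidableEq E] in
/-- **The cube principle without the swap**: a class `C = r '' univ` of an injective realisation of
a cube on which the red edge set of `h` is increasing and the conditioning pulls back to a lower
set satisfies the rigid counting inequality on `C ∩ Qs` for every up-set `𝓔` of edge sets, provided
that at every side point `ω` the red edges of `h` at the antipode are blue edges of `h` at `ω`. -/
theorem card_le_of_cube_edges_weak {E' : Type*} [Fintype E'] [DecidableEq E']
    (r : Config E' → Config E) (hr : Function.Injective r) (C : Finset (Config E))
    (hC : ∀ ζ, ζ ∈ C ↔ ∃ ω, r ω = ζ) (Qs : Set (Config E)) (hEv : IsLowerSet {ω | r ω ∈ Qs})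
    (h : V) (hT : ∀ 𝓔 : Set (Set E), IsUpperSet 𝓔 → IsUpperSet {ω | redEdges ends (r ω) h ∈ 𝓔})
    (hswap : ∀ ω, r ω ∈ Qs → redEdges ends (r (flipAll ω)) h ⊆ blueEdges ends (r ω) h)
    {𝓔 : Set (Set E)} (h𝓔 : IsUpperSet 𝓔) :
    (C.filter fun ζ => ζ ∈ Qs ∧ redEdges ends ζ h ∈ 𝓔).card ≤
      (C.filter fun ζ => ζ ∈ Qs ∧ blueEdges ends ζ h ∈ 𝓔).card := by
  have e1 : (C.filter fun ζ => ζ ∈ Qs ∧ redEdges ends ζ h ∈ 𝓔) =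
      (Finset.univ.filter fun ω => r ω ∈ Qs ∧ redEdges ends (r ω) h ∈ 𝓔).image r := by
    ext ζ
    simp only [Finset.mem_filter, Finset.mem_image, Finset.mem_univ, true_and]
    constructor
    · rintro ⟨hζ, hP⟩
      obtain ⟨ω, rfl⟩ := (hC ζ).1 hζ
      exact ⟨ω, hP, rfl⟩
    · rintro ⟨ω, hP, rfl⟩
      exact ⟨(hC _).2 ⟨ω, rfl⟩, hP⟩
  have e2 : (C.filter fun ζ => ζ ∈ Qs ∧ blueEdges ends ζ h ∈ 𝓔) =
      (Finset.univ.filter fun ω => r ω ∈ Qs ∧ blueEdges ends (r ω) h ∈ 𝓔).image r := by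
    ext ζ
    simp only [Finset.mem_filter, Finset.mem_image, Finset.mem_univ, true_and]
    constructor
    · rintro ⟨hζ, hP⟩
      obtain ⟨ω, rfl⟩ := (hC ζ).1 hζ
      exact ⟨ω, hP, rfl⟩
    · rintro ⟨ω, hP, rfl⟩
      exact ⟨(hC _).2 ⟨ω, rfl⟩, hP⟩
  rw [e1, e2, Finset.card_image_of_injective _ hr, Finset.card_image_of_injective _ hr]
  set A : Set (Config E') := {ω | redEdges ends (r ω) h ∈ 𝓔} with hA
  have hAup : IsUpperSet A := hT 𝓔 h𝓔
  have hBlow : IsLowerSet (flipAll ⁻¹' A) :=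
    fun ω ω' hle hω => hAup (flipAll_antitone_cube hle) hω
  have hAB : flipAll ⁻¹' (flipAll ⁻¹' A) = A := by
    ext ω
    simp only [Set.mem_preimage, flipAll_involutive ω]
  have harris := card_inter_le_of_cube hEv hAup hBlow hAB
  -- `L ∩ flipAll⁻¹ A ⊆ L ∩ {blue edges in 𝓔}`
  have hsub : (Finset.univ.filter (· ∈ {ω | r ω ∈ Qs} ∩ flipAll ⁻¹' A)) ⊆
      Finset.univ.filter fun ω => r ω ∈ Qs ∧ blueEdges ends (r ω) h ∈ 𝓔 := by
    intro ω hω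
    simp only [Finset.mem_filter, Finset.mem_univ, true_and, Set.mem_inter_iff, Set.mem_setOf_eq,
      Set.mem_preimage, hA] at hω ⊢
    exact ⟨hω.1, h𝓔 (hswap ω hω.1) hω.2⟩
  calc (Finset.univ.filter fun ω => r ω ∈ Qs ∧ redEdges ends (r ω) h ∈ 𝓔).card
      = (Finset.univ.filter (· ∈ {ω | r ω ∈ Qs} ∩ A)).card := by
        congr 1
    _ ≤ (Finset.univ.filter (· ∈ {ω | r ω ∈ Qs} ∩ flipAll ⁻¹' A)).card := harris
    _ ≤ _ := Finset.card_le_card hsub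

end CubeWeak

end LocRows

end Summit.Ventures.PercRepro2
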